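import Summits.Ventures.PercRepro.C041TriDomExcessMinorMain

/-!
# ROW C-041 — THE EQUALITY CASE OF THE EXCESS, IX: WALKS AVOIDING A SET, THE CROSSING AND BYPASS LEMMAS, THE
DOUBLE-CLASSES AFTER ONE CONTRACTION
(p6, gen 44; P6-TWOEXIT-LEAN.md §53 ADDENDUM 11, part I of III)

The converse of THEOREM (SEPARABLE ⟹ THE EXCESS VANISHES) — «the marks connected and no mark separating the other
two ⟹ `e ≥ 1`» — is proved by a CONTRACTION-ONLY minor induction at the level of statuses (part III,
`C041TriDomExcessConvMain`), down to the triangle and star minors of `C041TriDomExcessMinorMain`.  This part holds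
the walk vocabulary and the generic lemmas.

* `PAvoid st S` is present adjacency (`PAdjS`) with both ends off the set `S`, `PConnA st S k v` the existence of a
  present walk from `k` to `v` avoiding `S` (`Relation.ReflTransGen`); symmetric (`PConnA_symm`), monotone in the
  avoided set (`PConnA_mono`), invariant under statuses with the same present edges (`PConnA_congr`); a walk from
  a vertex off `S` ends off `S` (`PConnA_not_mem`).  `cls st x` is the double-class of `x` (the vertices
  double-connected to it, `DConn`); a double walk inside a class off `S` is an avoiding walk (`PConnA_of_DConn`).
* THE CROSSING LEMMA (`rtg_crossing`): a walk from a vertex outside a set to a vertex inside it has a step from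
  outside to inside.
* THE BYPASS LEMMA (`rtg_bypass`): a walk avoiding `S` between two vertices off `C` can be re-routed to avoid
  `S ∪ C` as well, provided any two boundary vertices of `C` (off `S ∪ C`, adjacent to `C`) are connected avoiding
  `S ∪ C` — induction on the walk, remembering the last boundary vertex reached while inside `C`.
* THE DOUBLE-CLASSES AFTER ONE CONTRACTION (`DConn_update_double_iff`): after `f : p–q` is made double, `k` is
  double-connected to `v` iff it was, or through `f` in one of its two directions; a class containing neither end
  is unchanged (`DConn_update_double_of_not`); present edges are unchanged (`presE_update_double`).
-/

namespace PercRepro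

namespace ZoneZ

namespace MultiExit

open ZoneData Finset

variable {V₁ E₁ U₁ U₂ : Type} (Z₁ : ZoneData V₁ E₁ U₁ U₂)

/-! ## Generic lemmas on reflexive–transitive closures -/

omit Z₁ in
/-- **THE CROSSING LEMMA**: a walk from a vertex outside `P` to a vertex inside `P` has a step from outside to
inside. -/
theorem rtg_crossing {α : Type*} {R : α → α → Prop} {P : α → Prop} {a b : α}
    (h : Relation.ReflTransGen R a b) (ha : ¬ P a) (hb : P b) : ∃ v w, R v w ∧ ¬ P v ∧ P w := by
  induction h with
  | refl => exact absurd hb ha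
  | @tail b c _ hbc ih =>
    by_cases hPb : P b
    · exact ih hPb
    · exact ⟨b, c, hbc, hPb, hb⟩

omit Z₁ in
/-- **THE BYPASS LEMMA**: a walk avoiding `S` between two vertices off `C` can be re-routed to avoid `S ∪ C` as
well, when any two boundary vertices of `C` (off `S ∪ C`, adjacent to `C`) are connected avoiding `S ∪ C`. -/
theorem rtg_bypass {α : Type*} {R : α → α → Prop} (hR : ∀ x y, R x y → R y x) (S C : Set α)
    (hC : ∀ t t', t ∉ S → t ∉ C → t' ∉ S → t' ∉ C → (∃ c ∈ C, R c t) → (∃ c ∈ C, R c t') →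
      Relation.ReflTransGen (fun x y => R x y ∧ x ∉ S ∪ C ∧ y ∉ S ∪ C) t t')
    {k v : α} (hk : k ∉ C) (hv : v ∉ C)
    (h : Relation.ReflTransGen (fun x y => R x y ∧ x ∉ S ∧ y ∉ S) k v) :
    Relation.ReflTransGen (fun x y => R x y ∧ x ∉ S ∪ C ∧ y ∉ S ∪ C) k v := by
  suffices H : ∀ w, Relation.ReflTransGen (fun x y => R x y ∧ x ∉ S ∧ y ∉ S) k w →
      (w ∉ C → Relation.ReflTransGen (fun x y => R x y ∧ x ∉ S ∪ C ∧ y ∉ S ∪ C) k w) ∧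
      (w ∈ C → ∃ t, t ∉ S ∧ t ∉ C ∧
        Relation.ReflTransGen (fun x y => R x y ∧ x ∉ S ∪ C ∧ y ∉ S ∪ C) k t ∧ ∃ c ∈ C, R c t) from
    (H v h).1 hv
  intro w hw
  induction hw with
  | refl => exact ⟨fun _ => Relation.ReflTransGen.refl, fun hkC => absurd hkC hk⟩
  | @tail b c _ hbc ih =>
    obtain ⟨hRbc, hbS, hcS⟩ := hbc
    refine ⟨fun hcC => ?_, fun hcC => ?_⟩
    · by_cases hbC : b ∈ C
      · obtain ⟨t, htS, htC, hkt, ht⟩ := ih.2 hbC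
        exact hkt.trans (hC t c htS htC hcS hcC ht ⟨b, hbC, hRbc⟩)
      · refine (ih.1 hbC).tail ⟨hRbc, ?_, ?_⟩
        · simp only [Set.mem_union, not_or]; exact ⟨hbS, hbC⟩
        · simp only [Set.mem_union, not_or]; exact ⟨hcS, hcC⟩
    · by_cases hbC : b ∈ C
      · exact ih.2 hbC
      · exact ⟨b, hbS, hbC, ih.1 hbC, c, hcC, hR _ _ hRbc⟩

/-! ## Walks by present edges avoiding a set -/

/-- Present adjacency with both ends off the set `S`. -/
def PAvoid (st : E₁ → EStat) (S : Set V₁) (x y : V₁) : Prop := PAdjS Z₁ st x y ∧ x ∉ S ∧ y ∉ S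

/-- `v` is connected to `k` by a present walk avoiding the set `S`. -/
def PConnA (st : E₁ → EStat) (S : Set V₁) (k v : V₁) : Prop := Relation.ReflTransGen (PAvoid Z₁ st S) k v

/-- The double-class of `x`: the vertices double-connected to it. -/
def cls (st : E₁ → EStat) (x : V₁) : Set V₁ := {v | DConn Z₁ st x v}

/-- Membership in a double-class. -/
theorem mem_cls {st : E₁ → EStat} {x v : V₁} : v ∈ cls Z₁ st x ↔ DConn Z₁ st x v := Iff.rfl

/-- Avoiding adjacency is symmetric. -/
theorem PAvoid_symm {st : E₁ → EStat} {S : Set V₁} {x y : V₁} (h : PAvoid Z₁ st S x y) : PAvoid Z₁ st S y x :=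
  ⟨AdjCol_symm Z₁ _ _ _ h.1, h.2.2, h.2.1⟩

/-- Avoiding connectivity is symmetric. -/
theorem PConnA_symm {st : E₁ → EStat} {S : Set V₁} {k v : V₁} (h : PConnA Z₁ st S k v) : PConnA Z₁ st S v k :=
  rtg_symm (fun _ _ => PAvoid_symm Z₁) h

/-- Avoiding connectivity composes. -/
theorem PConnA_trans {st : E₁ → EStat} {S : Set V₁} {k x v : V₁} (h1 : PConnA Z₁ st S k x)
    (h2 : PConnA Z₁ st S x v) : PConnA Z₁ st S k v :=
  Relation.ReflTransGen.trans h1 h2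

/-- Avoiding connectivity is reflexive. -/
theorem PConnA_refl (st : E₁ → EStat) (S : Set V₁) (k : V₁) : PConnA Z₁ st S k k :=
  Relation.ReflTransGen.refl

/-- Avoiding a larger set is the stronger statement. -/
theorem PConnA_mono {st : E₁ → EStat} {S S' : Set V₁} (hS : S ⊆ S') {k v : V₁} (h : PConnA Z₁ st S' k v) :
    PConnA Z₁ st S k v := by
  unfold PConnA at h ⊢
  induction h with
  | refl => exact Relation.ReflTransGen.refl
  | tail _ hbc ih => exact ih.tail ⟨hbc.1, fun h => hbc.2.1 (hS h), fun h => hbc.2.2 (hS h)⟩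

/-- The end of an avoiding walk from a vertex off `S` is off `S`. -/
theorem PConnA_not_mem {st : E₁ → EStat} {S : Set V₁} {k v : V₁} (h : PConnA Z₁ st S k v) (hk : k ∉ S) :
    v ∉ S := by
  unfold PConnA at h
  induction h with
  | refl => exact hk
  | tail _ hbc _ => exact hbc.2.2

/-- Statuses with the same present edges have the same present adjacency. -/
theorem PAdjS_congr {st st' : E₁ → EStat} (h : ∀ e, presE st e ↔ presE st' e) : PAdjS Z₁ st = PAdjS Z₁ st' := by
  funext x y
  unfold PAdjS AdjCol
  exact propext (exists_congr fun e => and_congr_right fun _ => h e)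

/-- Statuses with the same present edges have the same avoiding walks. -/
theorem PConnA_congr {st st' : E₁ → EStat} (h : ∀ e, presE st e ↔ presE st' e) (S : Set V₁) :
    PConnA Z₁ st S = PConnA Z₁ st' S := by
  unfold PConnA PAvoid
  rw [PAdjS_congr Z₁ h]

/-- Statuses with the same double edges have the same double connectivity. -/
theorem DConn_congr {st st' : E₁ → EStat} (h : ∀ e, dblE st e ↔ dblE st' e) : DConn Z₁ st = DConn Z₁ st' := by
  have hA : AdjCol Z₁ (dblE st) = AdjCol Z₁ (dblE st') := by
    funext x y
    unfold AdjCol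
    exact propext (exists_congr fun e => and_congr_right fun _ => h e)
  funext k v
  unfold DConn
  rw [hA]

/-- A double edge is present. -/
theorem presE_of_dblE {st : E₁ → EStat} {e : E₁} (h : dblE st e) : presE st e := by
  unfold presE
  unfold dblE at h
  rw [h]
  exact fun h => EStat.noConfusion h

/-- A double walk inside a class off `S` is an avoiding walk. -/
theorem PConnA_of_DConn {st : E₁ → EStat} {S : Set V₁} {k v : V₁} (h : DConn Z₁ st k v)
    (hS : ∀ w, DConn Z₁ st k w → w ∉ S) : PConnA Z₁ st S k v := by
  unfold DConn at h
  rw [mem_reach_singleton] at h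
  unfold PConnA
  induction h with
  | refl => exact Relation.ReflTransGen.refl
  | @tail b c hkb hbc ih =>
    obtain ⟨e, hj, hd⟩ := hbc
    refine ih.tail ⟨⟨e, hj, presE_of_dblE hd⟩, hS b ((mem_reach_singleton _ _ _).2 hkb), ?_⟩
    exact hS c ((mem_reach_singleton _ _ _).2 (hkb.tail ⟨e, hj, hd⟩))

/-- Two vertices in the class of a common vertex are double-connected. -/
theorem DConn_of_mem_cls {st : E₁ → EStat} {x v w : V₁} (hv : DConn Z₁ st x v) (hw : DConn Z₁ st x w) :
    DConn Z₁ st v w :=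
  DConn_trans Z₁ (DConn_symm Z₁ hv) hw

/-! ## The double-classes after one contraction -/

variable [DecidableEq E₁]

/-- Double connectivity is monotone under contracting an edge. -/
theorem DConn_mono_update_double {st : E₁ → EStat} (f : E₁) {x y : V₁} (h : DConn Z₁ st x y) :
    DConn Z₁ (Function.update st f .double) x y := by
  unfold DConn at h ⊢
  refine reach_mono (fun a b hab => ?_) h
  obtain ⟨e, hj, hd⟩ := hab
  refine ⟨e, hj, ?_⟩
  unfold dblE at hd ⊢
  by_cases hef : e = f
  · subst hef
    simp
  · rw [Function.update_of_ne hef]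
    exact hd

/-- **THE DOUBLE-CLASSES AFTER ONE CONTRACTION**: after `f : p–q` is made double, `k` is double-connected to `v`
iff it was, or through `f` in one of its two directions. -/
theorem DConn_update_double_iff {st : E₁ → EStat} {f : E₁} {p q : V₁} (hj : Z₁.Joins f p q) (k v : V₁) :
    DConn Z₁ (Function.update st f .double) k v ↔
      DConn Z₁ st k v ∨ (DConn Z₁ st k p ∧ DConn Z₁ st q v) ∨ (DConn Z₁ st k q ∧ DConn Z₁ st p v) := by
  constructor
  · intro h
    unfold DConn at h
    rw [mem_reach_singleton] at h
    induction h with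
    | refl => exact Or.inl (DConn_refl Z₁ st k)
    | @tail b c _ hbc ih =>
      obtain ⟨e, hj', hd⟩ := hbc
      by_cases hef : e = f
      · subst hef
        rcases joins_unique hj hj' with ⟨rfl, rfl⟩ | ⟨rfl, rfl⟩
        · rcases ih with h | ⟨h1, _⟩ | ⟨h1, _⟩
          · exact Or.inr (Or.inl ⟨h, DConn_refl Z₁ st _⟩)
          · exact Or.inr (Or.inl ⟨h1, DConn_refl Z₁ st _⟩)
          · exact Or.inl h1
        · rcases ih with h | ⟨h1, _⟩ | ⟨h1, _⟩
          · exact Or.inr (Or.inr ⟨h, DConn_refl Z₁ st _⟩)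
          · exact Or.inl h1
          · exact Or.inr (Or.inr ⟨h1, DConn_refl Z₁ st _⟩)
      · have hd2 : dblE st e := by
          unfold dblE at hd ⊢
          rwa [Function.update_of_ne hef] at hd
        have hbc' : DConn Z₁ st b c := DConn_of_dblE Z₁ hd2 hj'
        rcases ih with h | ⟨h1, h2⟩ | ⟨h1, h2⟩
        · exact Or.inl (DConn_trans Z₁ h hbc')
        · exact Or.inr (Or.inl ⟨h1, DConn_trans Z₁ h2 hbc'⟩)
        · exact Or.inr (Or.inr ⟨h1, DConn_trans Z₁ h2 hbc'⟩)
  · have hf : DConn Z₁ (Function.update st f .double) p q :=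
      DConn_of_dblE Z₁ (by unfold dblE; simp) hj
    rintro (h | ⟨h1, h2⟩ | ⟨h1, h2⟩)
    · exact DConn_mono_update_double Z₁ f h
    · exact DConn_trans Z₁ (DConn_trans Z₁ (DConn_mono_update_double Z₁ f h1) hf)
        (DConn_mono_update_double Z₁ f h2)
    · exact DConn_trans Z₁ (DConn_trans Z₁ (DConn_mono_update_double Z₁ f h1) (DConn_symm Z₁ hf))
        (DConn_mono_update_double Z₁ f h2)

/-- A class containing neither end of the contracted edge is unchanged. -/
theorem DConn_update_double_of_not {st : E₁ → EStat} {f : E₁} {p q : V₁} (hj : Z₁.Joins f p q) {k : V₁}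
    (hp : ¬ DConn Z₁ st k p) (hq : ¬ DConn Z₁ st k q) (v : V₁) :
    DConn Z₁ (Function.update st f .double) k v ↔ DConn Z₁ st k v := by
  rw [DConn_update_double_iff Z₁ hj]
  constructor
  · rintro (h | ⟨h1, _⟩ | ⟨h1, _⟩)
    · exact h
    · exact absurd h1 hp
    · exact absurd h1 hq
  · exact Or.inl

/-- A class containing neither end of the contracted edge is unchanged (set form). -/
theorem cls_update_double_of_not {st : E₁ → EStat} {f : E₁} {p q : V₁} (hj : Z₁.Joins f p q) {k : V₁}
    (hp : ¬ DConn Z₁ st k p) (hq : ¬ DConn Z₁ st k q) :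
    cls Z₁ (Function.update st f .double) k = cls Z₁ st k := by
  ext v
  exact DConn_update_double_of_not Z₁ hj hp hq v

/-- Contracting a free edge keeps the present edges. -/
theorem presE_update_double {st : E₁ → EStat} {f : E₁} (hf : st f = .free) (e : E₁) :
    presE (Function.update st f .double) e ↔ presE st e := by
  unfold presE
  by_cases hef : e = f
  · subst hef
    rw [hf]
    simp
  · rw [Function.update_of_ne hef]

/-- Contracting a free edge keeps the avoiding walks (for the same avoided set). -/
theorem PConnA_update_double {st : E₁ → EStat} {f : E₁} (hf : st f = .free) (S : Set V₁) :
    PConnA Z₁ (Function.update st f .double) S = PConnA Z₁ st S :=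
  PConnA_congr Z₁ (fun e => presE_update_double hf e) S

/-- The class of `k` after contracting `f : p–q` with `p` in it lies in the old classes of `k` and `q`. -/
theorem DConn_update_double_sub {st : E₁ → EStat} {f : E₁} {p q : V₁} (hj : Z₁.Joins f p q) {k v : V₁}
    (hq : ¬ DConn Z₁ st k q) (h : DConn Z₁ (Function.update st f .double) k v) :
    DConn Z₁ st k v ∨ DConn Z₁ st q v := by
  rw [DConn_update_double_iff Z₁ hj] at h
  rcases h with h | ⟨_, h2⟩ | ⟨h1, _⟩
  · exact Or.inl h
  · exact Or.inr h2
  · exact absurd h1 hq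

end MultiExit

end ZoneZ

end PercRepro
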